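import Literature.Probability.Percolation.SelfRefinementMeasure
import Literature.Probability.Percolation.KohlerSchindlerTassionRSW
import Summits.CriticalPhenomena.CardyFormulaZ2.Theorems.CardySelfRefinementCriticalPathRSWStubCone3Pivot

/-!
# Stub `stub_cone3` of line `finite-size-envelope` (crux `CriticalPathRSW`), part 11:
the selector term of Russo's formula as a sum over the eight own-coin patterns

Support file for item `stmt-CriticalPhenomena-10267` (stub `stub_cone3`).  With the coin law
`P = prodBernoulli (refinementParam 3 ρ c)` and the pulled-back crossing event `Â` of the box
`[-3n, 3n] × [-9n, 9n]`, the selector `σ = (b, d, 2)` of the tuple `(b, d)` contributes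
`P(Â^{σ←1}) - P(Â^{σ←0}) = P(G) - P(N)` to the derivative, where `N = Â^{σ←0} \ Â^{σ←1}` and
`G = Â^{σ←1} \ Â^{σ←0}` (`Â^{σ←0} = {S | S \ {σ} ∈ Â}`, `Â^{σ←1} = {S | insert σ S ∈ Â}`).
Conditioning on the shared coin and the three own coins (all fair) gives

* `Cone3.real_N_le` — `P(N) ≤ q · Σ_{pat ⊆ {o₀,o₁,o₂}} P(Z⟪T, T(pat)⟫ \ Z⟪T, ∅⟫)`,
* `Cone3.real_G_ge` — `q · Σ_{pat} P(Z⟪T, T⟫ \ Z⟪T, T(pat)⟫) ≤ P(G)`,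

with the same constant `q = P(cylinder over the four coins) ∈ (0, 1]` and `T(pat)` the sub-edges
whose own coin lies in `pat`; and `Cone3.sections_eq_of_irrelevant` — if the sub-edges never
matter for the crossing (tuple outside the box, or inside a side) then `Â^{σ←0} = Â^{σ←1}`.

References: Grimmett 1999 §2.4 (conditioning Russo's formula on the other local coins);
Aizenman–Grimmett 1991 §2.
-/

noncomputable section

namespace Summit.CriticalPhenomena.CardyFormulaZ2.Cruxes.CriticalPathRSW.FiniteSizeEnvelope

open Set MeasureTheory
open Literature.Probability.LatticeModels Literature.Probability.Percolation

namespace Cone3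

variable {n : ℕ} {ρ c : ℝ} {b : Site 2} {d d' : Fin 2}

set_option quotPrecheck false

/-- The local frame of the tuple `(b, d)`: `pt⟪α, β⟫ = 3b + α e_d + β e_{d'}`. -/
local notation "pt⟪" α ", " β "⟫" =>
  ((3 : ℤ) • b + (α : ℤ) • (Pi.single d (1 : ℤ) : Site 2) + (β : ℤ) • (Pi.single d' (1 : ℤ) : Site 2))

/-- The open labels of a coin configuration. -/
local notation "Op⟪" S "⟫" => {e : Site 2 × Fin 2 | RefinementOpen 3 S e}

/-- The override event: close `C`, open `A`, and ask for a left-right crossing of the box. -/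
local notation "Z⟪" C ", " A "⟫" =>
  {S : Set (Site 2 × Fin 2 × Fin 3) |
    edgeConfig ((Op⟪S⟫ \ C) ∪ A) ∈ KST2023.crossing (3 * n) (3 * (3 * n))}

/-- The pulled-back crossing event. -/
local notation "Â" => ((refinementConfig 3) ⁻¹' KST2023.crossing (3 * n) (3 * (3 * n)))

/-- The three sub-edges of the tuple. -/
local notation "Tl" =>
  ({(pt⟪0, 0⟫, d), (pt⟪1, 0⟫, d), (pt⟪2, 0⟫, d)} : Set (Site 2 × Fin 2))

/-- The sub-edges whose own coin lies in `X`. -/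
local notation "Tof⟪" X "⟫" =>
  {e : Site 2 × Fin 2 | (e = (pt⟪0, 0⟫, d) ∧ (pt⟪0, 0⟫, d, (0 : Fin 3)) ∈ X) ∨
    (e = (pt⟪1, 0⟫, d) ∧ (pt⟪1, 0⟫, d, (0 : Fin 3)) ∈ X) ∨ (e = (pt⟪2, 0⟫, d) ∧ (pt⟪2, 0⟫, d, (0 : Fin 3)) ∈ X)}

/-- All sub-edges if the shared coin lies in `X`, nothing otherwise. -/
local notation "Th⟪" X "⟫" =>
  {e : Site 2 × Fin 2 | (e = (pt⟪0, 0⟫, d) ∨ e = (pt⟪1, 0⟫, d) ∨ e = (pt⟪2, 0⟫, d)) ∧ (b, d, (1 : Fin 3)) ∈ X}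

/-- The three own coins, as a `Finset`. -/
local notation "F₃" =>
  ({(pt⟪0, 0⟫, d, (0 : Fin 3)), (pt⟪1, 0⟫, d, (0 : Fin 3)), (pt⟪2, 0⟫, d, (0 : Fin 3))} :
    Finset (Site 2 × Fin 2 × Fin 3))

/-- The shared coin and the three own coins, as a `Finset`. -/
local notation "F₄" =>
  ({(b, d, (1 : Fin 3)), (pt⟪0, 0⟫, d, (0 : Fin 3)), (pt⟪1, 0⟫, d, (0 : Fin 3)), (pt⟪2, 0⟫, d, (0 : Fin 3))} :
    Finset (Site 2 × Fin 2 × Fin 3))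

/-- The coin law. -/
local notation "P" => (prodBernoulli (refinementParam 3 ρ c))

/-! ### The four fair coins -/

/-- The shared coin is not an own coin. -/
theorem shared_notMem_F₃ : (b, d, (1 : Fin 3)) ∉ F₃ := by simp

/-- Every coin of `F₄` is fair. -/
theorem coe_param_F₄ (hd : d' ≠ d) {i : Site 2 × Fin 2 × Fin 3} (hi : i ∈ F₄) :
    ((refinementParam 3 ρ c i : unitInterval) : ℝ) = 1 / 2 := by
  simp only [Finset.mem_insert, Finset.mem_singleton] at hi
  rcases hi with rfl | rfl | rfl | rfl
  · exact coe_param_shared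
  · exact coe_param_sub hd 0
  · exact coe_param_sub hd 1
  · exact coe_param_sub hd 2

/-- All cylinders over `F₄` have the same probability `(1/2)^{|F₄|}`. -/
theorem real_cyl_F₄ (hd : d' ≠ d) (X : Set (Site 2 × Fin 2 × Fin 3)) :
    (P).real (localCylinder (↑F₄ : Set (Site 2 × Fin 2 × Fin 3)) X) = (1 / 2) ^ (F₄).card := by
  classical
  rw [real_localCylinder_eq, ← Finset.prod_const]
  refine Finset.prod_congr rfl fun i hi => ?_
  rw [coe_param_F₄ hd hi]
  split_ifs <;> norm_num

/-- The events `Z⟪C, A⟫ \ Z⟪C', A'⟫` with `T ⊆ C, C'` are independent of the four coins. -/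
theorem determinedBy_Zdiff_F₄ (hd : d' ≠ d) (A A' : Set (Site 2 × Fin 2)) :
    DeterminedBy (Z⟪Tl, A⟫ \ Z⟪Tl, A'⟫) (↑F₄ : Set (Site 2 × Fin 2 × Fin 3))ᶜ := by
  have hK : (↑F₄ : Set (Site 2 × Fin 2 × Fin 3)) ⊆ {(b, d, (2 : Fin 3)), (b, d, (1 : Fin 3)),
      (pt⟪0, 0⟫, d, (0 : Fin 3)), (pt⟪1, 0⟫, d, (0 : Fin 3)), (pt⟪2, 0⟫, d, (0 : Fin 3))} ∪
        (fun ℓ : Site 2 × Fin 2 => (ℓ.1, ℓ.2, (0 : Fin 3))) '' (∅ : Set (Site 2 × Fin 2)) := by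
    intro i hi
    simp only [Finset.coe_insert, Finset.coe_singleton, Set.mem_insert_iff, Set.mem_singleton_iff] at hi
    left
    rcases hi with rfl | rfl | rfl | rfl <;> simp
  have hC : ∀ A'' : Set (Site 2 × Fin 2), ∀ e : Site 2 × Fin 2,
      (e = (pt⟪0, 0⟫, d) ∨ e = (pt⟪1, 0⟫, d) ∨ e = (pt⟪2, 0⟫, d) ∨ e ∈ (∅ : Set (Site 2 × Fin 2))) →
      e ∈ Tl ∪ A'' := by
    intro A'' e he
    rcases he with rfl | rfl | rfl | he
    · exact Or.inl (by simp)
    · exact Or.inl (by simp)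
    · exact Or.inl (by simp)
    · exact absurd he (Set.notMem_empty e)
  exact determinedBy_sdiff (determinedBy_Z hd hK (hC A)) (determinedBy_Z hd hK (hC A'))

/-! ### The sections on a cylinder over the four coins -/

/-- On a cylinder fixing the own coins, `Tof⟪S⟫ = Tof⟪pattern⟫`. -/
theorem Tof_eq_of_cyl {S X : Set (Site 2 × Fin 2 × Fin 3)}
    (h : ∀ j : ℤ, (j = 0 ∨ j = 1 ∨ j = 2) → ((pt⟪j, 0⟫, d, (0 : Fin 3)) ∈ S ↔ (pt⟪j, 0⟫, d, (0 : Fin 3)) ∈ X)) :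
    Tof⟪S⟫ = Tof⟪X⟫ := by
  ext e
  simp only [Set.mem_setOf_eq]
  rw [h 0 (Or.inl rfl), h 1 (Or.inr (Or.inl rfl)), h 2 (Or.inr (Or.inr rfl))]

/-- If the shared coin is off, `Th⟪S⟫ = ∅`. -/
theorem Th_eq_empty {S : Set (Site 2 × Fin 2 × Fin 3)} (h : (b, d, (1 : Fin 3)) ∉ S) : Th⟪S⟫ = ∅ := by
  ext e
  simp only [Set.mem_setOf_eq, Set.mem_empty_iff_false, iff_false, not_and]
  exact fun _ => h

/-- If the shared coin is on, `Th⟪S⟫ = T`. -/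
theorem Th_eq_Tl {S : Set (Site 2 × Fin 2 × Fin 3)} (h : (b, d, (1 : Fin 3)) ∈ S) : Th⟪S⟫ = Tl := by
  ext e
  simp only [Set.mem_setOf_eq, Set.mem_insert_iff, Set.mem_singleton_iff, h, and_true]

/-- `Tof⟪X⟫ ⊆ T`. -/
theorem Tof_subset (X : Set (Site 2 × Fin 2 × Fin 3)) : Tof⟪X⟫ ⊆ Tl := by
  intro e he
  rcases he with ⟨rfl, -⟩ | ⟨rfl, -⟩ | ⟨rfl, -⟩ <;> simp

/-! ### Measurability of the sections -/

/-- The lower selector section is measurable. -/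
theorem measurableSet_section_off :
    MeasurableSet {S : Set (Site 2 × Fin 2 × Fin 3) | S \ {(b, d, (2 : Fin 3))} ∈ Â} := by
  have hAm : MeasurableSet Â :=
    measurable_refinementConfig 3 (measurableSet_openCrossing_of_countable _ _ _)
  have heq : {S : Set (Site 2 × Fin 2 × Fin 3) | S \ {(b, d, (2 : Fin 3))} ∈ Â} =
      (fun ω : Set (Site 2 × Fin 2 × Fin 3) => ω \ {(b, d, (2 : Fin 3))} ∪ ∅) ⁻¹' Â := by
    ext S; simp only [Set.mem_setOf_eq, Set.mem_preimage, Set.union_empty]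
  rw [heq]
  exact measurable_diff_union _ _ hAm

/-- The upper selector section is measurable. -/
theorem measurableSet_section_on :
    MeasurableSet {S : Set (Site 2 × Fin 2 × Fin 3) | insert (b, d, (2 : Fin 3)) S ∈ Â} := by
  have hAm : MeasurableSet Â :=
    measurable_refinementConfig 3 (measurableSet_openCrossing_of_countable _ _ _)
  have heq : {S : Set (Site 2 × Fin 2 × Fin 3) | insert (b, d, (2 : Fin 3)) S ∈ Â} =
      (fun ω : Set (Site 2 × Fin 2 × Fin 3) => ω \ ∅ ∪ {(b, d, (2 : Fin 3))}) ⁻¹' Â := by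
    ext S; simp only [Set.mem_setOf_eq, Set.mem_preimage, Set.sdiff_empty, Set.union_singleton]
  rw [heq]
  exact measurable_diff_union _ _ hAm

/-! ### The two bounds -/

/-- **The negative section is dominated by the pattern sum**:
`P(N) ≤ q · Σ_{pat ⊆ F₃} P(Z⟪T, T(pat)⟫ \ Z⟪T, ∅⟫)`, `q = P(cylinder over F₄)`. -/
theorem real_N_le (hd : d' ≠ d) :
    (P).real ({S : Set (Site 2 × Fin 2 × Fin 3) | S \ {(b, d, (2 : Fin 3))} ∈ Â} \
        {S | insert (b, d, (2 : Fin 3)) S ∈ Â}) ≤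
      (P).real (localCylinder (↑F₄ : Set (Site 2 × Fin 2 × Fin 3)) ∅) *
        ∑ pat ∈ (F₃).powerset, (P).real (Z⟪Tl, Tof⟪(↑pat : Set (Site 2 × Fin 2 × Fin 3))⟫⟫ \
          Z⟪Tl, (∅ : Set (Site 2 × Fin 2))⟫) := by
  classical
  set N := {S : Set (Site 2 × Fin 2 × Fin 3) | S \ {(b, d, (2 : Fin 3))} ∈ Â} \
    {S | insert (b, d, (2 : Fin 3)) S ∈ Â} with hN
  have hNm : MeasurableSet N := measurableSet_section_off.diff measurableSet_section_on
  -- decompose along the cylinders over `F₄ = insert h F₃`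
  rw [measureReal_eq_sum_inter_localCylinder P hNm F₄]
  have hpow : (F₄).powerset = (F₃).powerset ∪ (F₃).powerset.image (insert (b, d, (1 : Fin 3))) := by
    rw [← Finset.powerset_insert]
  have hdisj : Disjoint (F₃).powerset ((F₃).powerset.image (insert (b, d, (1 : Fin 3)))) := by
    rw [Finset.disjoint_left]
    intro S hS hS'
    obtain ⟨T, -, rfl⟩ := Finset.mem_image.1 hS'
    exact shared_notMem_F₃ (Finset.mem_powerset.1 hS (Finset.mem_insert_self _ T))
  have hinj : Set.InjOn (insert (b, d, (1 : Fin 3))) (↑(F₃).powerset : Set (Finset (Site 2 × Fin 2 × Fin 3))) := by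
    intro S hS T hT hST
    have heS : (b, d, (1 : Fin 3)) ∉ S := fun h => shared_notMem_F₃ (Finset.mem_powerset.1 hS h)
    have heT : (b, d, (1 : Fin 3)) ∉ T := fun h => shared_notMem_F₃ (Finset.mem_powerset.1 hT h)
    rw [← Finset.erase_insert heS, ← Finset.erase_insert heT, hST]
  rw [hpow, Finset.sum_union hdisj, Finset.sum_image hinj, Finset.mul_sum]
  -- the second half vanishes: on those cylinders the shared coin is on, so `Â^{σ←1} ⊇ Â^{σ←0}`
  have hzero : ∀ pat ∈ (F₃).powerset, (P).real (N ∩ localCylinder (↑F₄ : Set (Site 2 × Fin 2 × Fin 3))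
      (↑(insert (b, d, (1 : Fin 3)) pat) : Set (Site 2 × Fin 2 × Fin 3))) = 0 := by
    intro pat _
    have hempty : N ∩ localCylinder (↑F₄ : Set (Site 2 × Fin 2 × Fin 3))
        (↑(insert (b, d, (1 : Fin 3)) pat) : Set (Site 2 × Fin 2 × Fin 3)) = ∅ := by
      ext S
      simp only [Set.mem_inter_iff, Set.mem_empty_iff_false, iff_false, not_and]
      intro hS hcyl
      have hh : (b, d, (1 : Fin 3)) ∈ S := (hcyl _ (by simp)).2 (by simp)
      apply hS.2
      have h1 := hS.1
      simp only [Set.mem_setOf_eq, section_selector_off hd, section_selector_on hd] at h1 ⊢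
      rw [Th_eq_Tl hh]
      exact crossing_mono (Set.union_subset_union_right _ (Tof_subset S)) h1
    rw [hempty, measureReal_empty]
  rw [Finset.sum_eq_zero hzero, add_zero]
  -- the first half: on the cylinder of `pat ⊆ F₃` the shared coin is off and the own coins follow `pat`
  refine Finset.sum_le_sum fun pat hpat => ?_
  have hpatF : pat ⊆ F₃ := Finset.mem_powerset.1 hpat
  have hsub : N ∩ localCylinder (↑F₄ : Set (Site 2 × Fin 2 × Fin 3)) ↑pat ⊆
      (Z⟪Tl, Tof⟪(↑pat : Set (Site 2 × Fin 2 × Fin 3))⟫⟫ \ Z⟪Tl, (∅ : Set (Site 2 × Fin 2))⟫) ∩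
        localCylinder (↑F₄ : Set (Site 2 × Fin 2 × Fin 3)) ↑pat := by
    rintro S ⟨hS, hcyl⟩
    have hh : (b, d, (1 : Fin 3)) ∉ S := fun h =>
      shared_notMem_F₃ (hpatF (Finset.mem_coe.1 ((hcyl _ (by simp)).1 h)))
    have ho : ∀ j : ℤ, (j = 0 ∨ j = 1 ∨ j = 2) →
        ((pt⟪j, 0⟫, d, (0 : Fin 3)) ∈ S ↔ (pt⟪j, 0⟫, d, (0 : Fin 3)) ∈ (↑pat : Set (Site 2 × Fin 2 × Fin 3))) := by
      intro j hj
      refine hcyl _ ?_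
      rcases hj with rfl | rfl | rfl <;> simp
    refine ⟨⟨?_, ?_⟩, hcyl⟩
    · have h1 := hS.1
      simp only [Set.mem_setOf_eq, section_selector_off hd] at h1
      rw [Tof_eq_of_cyl ho] at h1
      exact h1
    · intro h2
      apply hS.2
      simp only [Set.mem_setOf_eq, section_selector_on hd]
      rw [Th_eq_empty hh]
      exact h2
  calc (P).real (N ∩ localCylinder (↑F₄ : Set (Site 2 × Fin 2 × Fin 3)) ↑pat)
      ≤ (P).real ((Z⟪Tl, Tof⟪(↑pat : Set (Site 2 × Fin 2 × Fin 3))⟫⟫ \ Z⟪Tl, (∅ : Set (Site 2 × Fin 2))⟫) ∩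
          localCylinder (↑F₄ : Set (Site 2 × Fin 2 × Fin 3)) ↑pat) := measureReal_mono hsub
    _ = (P).real (localCylinder (↑F₄ : Set (Site 2 × Fin 2 × Fin 3)) ↑pat) *
          (P).real (Z⟪Tl, Tof⟪(↑pat : Set (Site 2 × Fin 2 × Fin 3))⟫⟫ \ Z⟪Tl, (∅ : Set (Site 2 × Fin 2))⟫) := by
        rw [Set.inter_comm]
        exact real_localCylinder_inter _ _ _ (determinedBy_Zdiff_F₄ hd _ _)
          ((measurableSet_Z _ _).diff (measurableSet_Z _ _))
    _ = (P).real (localCylinder (↑F₄ : Set (Site 2 × Fin 2 × Fin 3)) ∅) *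
          (P).real (Z⟪Tl, Tof⟪(↑pat : Set (Site 2 × Fin 2 × Fin 3))⟫⟫ \ Z⟪Tl, (∅ : Set (Site 2 × Fin 2))⟫) := by
        rw [real_cyl_F₄ hd, real_cyl_F₄ hd]

/-- **The positive section dominates the complementary pattern sum**:
`q · Σ_{pat ⊆ F₃} P(Z⟪T, T⟫ \ Z⟪T, T(pat)⟫) ≤ P(G)`. -/
theorem real_G_ge (hd : d' ≠ d) :
    (P).real (localCylinder (↑F₄ : Set (Site 2 × Fin 2 × Fin 3)) ∅) *
        ∑ pat ∈ (F₃).powerset, (P).real (Z⟪Tl, Tl⟫ \ Z⟪Tl, Tof⟪(↑pat : Set (Site 2 × Fin 2 × Fin 3))⟫⟫) ≤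
      (P).real ({S : Set (Site 2 × Fin 2 × Fin 3) | insert (b, d, (2 : Fin 3)) S ∈ Â} \
        {S | S \ {(b, d, (2 : Fin 3))} ∈ Â}) := by
  classical
  set G := {S : Set (Site 2 × Fin 2 × Fin 3) | insert (b, d, (2 : Fin 3)) S ∈ Â} \
    {S | S \ {(b, d, (2 : Fin 3))} ∈ Â} with hG
  have hGm : MeasurableSet G := measurableSet_section_on.diff measurableSet_section_off
  rw [measureReal_eq_sum_inter_localCylinder P hGm F₄]
  have hpow : (F₄).powerset = (F₃).powerset ∪ (F₃).powerset.image (insert (b, d, (1 : Fin 3))) := by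
    rw [← Finset.powerset_insert]
  have hdisj : Disjoint (F₃).powerset ((F₃).powerset.image (insert (b, d, (1 : Fin 3)))) := by
    rw [Finset.disjoint_left]
    intro S hS hS'
    obtain ⟨T, -, rfl⟩ := Finset.mem_image.1 hS'
    exact shared_notMem_F₃ (Finset.mem_powerset.1 hS (Finset.mem_insert_self _ T))
  have hinj : Set.InjOn (insert (b, d, (1 : Fin 3))) (↑(F₃).powerset : Set (Finset (Site 2 × Fin 2 × Fin 3))) := by
    intro S hS T hT hST
    have heS : (b, d, (1 : Fin 3)) ∉ S := fun h => shared_notMem_F₃ (Finset.mem_powerset.1 hS h)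
    have heT : (b, d, (1 : Fin 3)) ∉ T := fun h => shared_notMem_F₃ (Finset.mem_powerset.1 hT h)
    rw [← Finset.erase_insert heS, ← Finset.erase_insert heT, hST]
  rw [hpow, Finset.sum_union hdisj, Finset.sum_image hinj, Finset.mul_sum]
  -- drop the first half and identify the second
  have hnonneg : 0 ≤ ∑ pat ∈ (F₃).powerset, (P).real (G ∩ localCylinder (↑F₄ : Set (Site 2 × Fin 2 × Fin 3)) ↑pat) :=
    Finset.sum_nonneg fun _ _ => measureReal_nonneg
  refine le_trans ?_ (le_add_of_nonneg_left hnonneg)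
  refine Finset.sum_le_sum fun pat hpat => ?_
  have hpatF : pat ⊆ F₃ := Finset.mem_powerset.1 hpat
  have hsub : (Z⟪Tl, Tl⟫ \ Z⟪Tl, Tof⟪(↑pat : Set (Site 2 × Fin 2 × Fin 3))⟫⟫) ∩
      localCylinder (↑F₄ : Set (Site 2 × Fin 2 × Fin 3)) (↑(insert (b, d, (1 : Fin 3)) pat) : Set (Site 2 × Fin 2 × Fin 3)) ⊆
        G ∩ localCylinder (↑F₄ : Set (Site 2 × Fin 2 × Fin 3)) (↑(insert (b, d, (1 : Fin 3)) pat) : Set (Site 2 × Fin 2 × Fin 3)) := by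
    rintro S ⟨hS, hcyl⟩
    have hh : (b, d, (1 : Fin 3)) ∈ S := (hcyl _ (by simp)).2 (by simp)
    have ho : ∀ j : ℤ, (j = 0 ∨ j = 1 ∨ j = 2) →
        ((pt⟪j, 0⟫, d, (0 : Fin 3)) ∈ S ↔ (pt⟪j, 0⟫, d, (0 : Fin 3)) ∈ (↑pat : Set (Site 2 × Fin 2 × Fin 3))) := by
      intro j hj
      have hjF : (pt⟪j, 0⟫, d, (0 : Fin 3)) ∈ F₄ := by rcases hj with rfl | rfl | rfl <;> simp
      rw [hcyl _ (Finset.mem_coe.2 hjF), Finset.coe_insert, Set.mem_insert_iff]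
      constructor
      · rintro (h | h)
        · exact absurd h (by simp)
        · exact h
      · exact fun h => Or.inr h
    refine ⟨⟨?_, ?_⟩, hcyl⟩
    · simp only [Set.mem_setOf_eq, section_selector_on hd]
      rw [Th_eq_Tl hh]
      exact hS.1
    · intro h2
      apply hS.2
      simp only [Set.mem_setOf_eq, section_selector_off hd] at h2
      rw [Tof_eq_of_cyl ho] at h2
      exact h2
  calc (P).real (localCylinder (↑F₄ : Set (Site 2 × Fin 2 × Fin 3)) ∅) *
        (P).real (Z⟪Tl, Tl⟫ \ Z⟪Tl, Tof⟪(↑pat : Set (Site 2 × Fin 2 × Fin 3))⟫⟫)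
      = (P).real (localCylinder (↑F₄ : Set (Site 2 × Fin 2 × Fin 3))
            (↑(insert (b, d, (1 : Fin 3)) pat) : Set (Site 2 × Fin 2 × Fin 3))) *
          (P).real (Z⟪Tl, Tl⟫ \ Z⟪Tl, Tof⟪(↑pat : Set (Site 2 × Fin 2 × Fin 3))⟫⟫) := by
        rw [real_cyl_F₄ hd, real_cyl_F₄ hd]
    _ = (P).real ((Z⟪Tl, Tl⟫ \ Z⟪Tl, Tof⟪(↑pat : Set (Site 2 × Fin 2 × Fin 3))⟫⟫) ∩
          localCylinder (↑F₄ : Set (Site 2 × Fin 2 × Fin 3))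
            (↑(insert (b, d, (1 : Fin 3)) pat) : Set (Site 2 × Fin 2 × Fin 3))) := by
        rw [Set.inter_comm]
        exact (real_localCylinder_inter _ _ _ (determinedBy_Zdiff_F₄ hd _ _)
          ((measurableSet_Z _ _).diff (measurableSet_Z _ _))).symm
    _ ≤ (P).real (G ∩ localCylinder (↑F₄ : Set (Site 2 × Fin 2 × Fin 3))
            (↑(insert (b, d, (1 : Fin 3)) pat) : Set (Site 2 × Fin 2 × Fin 3))) := measureReal_mono hsub

/-! ### Tuples whose sub-edges never matter -/

/-- If the sub-edges never matter for the crossing, the two selector sections coincide. -/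
theorem sections_eq_of_irrelevant (hd : d' ≠ d)
    (hirr : ∀ (U A : Set (Site 2 × Fin 2)), A ⊆ Tl →
      (edgeConfig ((U \ Tl) ∪ A) ∈ KST2023.crossing (3 * n) (3 * (3 * n)) ↔
        edgeConfig (U \ Tl) ∈ KST2023.crossing (3 * n) (3 * (3 * n)))) :
    {S : Set (Site 2 × Fin 2 × Fin 3) | S \ {(b, d, (2 : Fin 3))} ∈ Â} = {S | insert (b, d, (2 : Fin 3)) S ∈ Â} := by
  ext S
  simp only [Set.mem_setOf_eq, section_selector_off hd, section_selector_on hd]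
  rw [hirr _ _ (Tof_subset S), hirr _ _ (fun e he => ?_)]
  rcases he.1 with rfl | rfl | rfl <;> simp

end Cone3

/-- **Registered sub-goal `stub_cone3_sections` of stub `stub_cone3`** (`Cone3.real_cyl_F₄` with all local notations
expanded). -/
theorem stub_cone3_sections : ∀ {ρ c : ℝ} {b : Site 2} {d d' : Fin 2} (hd : d' ≠ d) (X : Set (Site 2 × Fin 2 × Fin 3)), (((prodBernoulli (refinementParam 3 ρ c)))).real (localCylinder (↑(({(b, d, (1 : Fin 3)), ((((3 : ℤ) • b + ((0) : ℤ) • (Pi.single d (1 : ℤ) : Site 2) + ((0) : ℤ) • (Pi.single d' (1 : ℤ) : Site 2))), d, (0 : Fin 3)), ((((3 : ℤ) • b + ((1) : ℤ) • (Pi.single d (1 : ℤ) : Site 2) + ((0) : ℤ) • (Pi.single d' (1 : ℤ) : Site 2))), d, (0 : Fin 3)), ((((3 : ℤ) • b + ((2) : ℤ) • (Pi.single d (1 : ℤ) : Site 2) + ((0) : ℤ) • (Pi.single d' (1 : ℤ) : Site 2))), d, (0 : Fin 3))} : Finset (Site 2 × Fin 2 × Fin 3))) : Set (Site 2 × Fin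 2 × Fin 3)) X) = (1 / 2) ^ ((({(b, d, (1 : Fin 3)), ((((3 : ℤ) • b + ((0) : ℤ) • (Pi.single d (1 : ℤ) : Site 2) + ((0) : ℤ) • (Pi.single d' (1 : ℤ) : Site 2))), d, (0 : Fin 3)), ((((3 : ℤ) • b + ((1) : ℤ) • (Pi.single d (1 : ℤ) : Site 2) + ((0) : ℤ) • (Pi.single d' (1 : ℤ) : Site 2))), d, (0 : Fin 3)), ((((3 : ℤ) • b + ((2) : ℤ) • (Pi.single d (1 : ℤ) : Site 2) + ((0) : ℤ) • (Pi.single d' (1 : ℤ) : Site 2))), d, (0 : Fin 3))} : Finset (Site 2 × Fin 2 × Fin 3)))).card := by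
  intro ρ c b d d' hd X
  exact Cone3.real_cyl_F₄ hd X

end Summit.CriticalPhenomena.CardyFormulaZ2.Cruxes.CriticalPathRSW.FiniteSizeEnvelope

end
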